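import Summits.ResolutionOfSingularities.ResolutionOfSingularities.Theorems.MarkedTransferCampaignW46ThreefoldsTauTwoWitness
import Literature.AlgebraicGeometry.Resolution.BlowupChartMembership
import HarnessLib

/-!
# [OURS · L1 W4.6 rung (ii-τ2)] THE `A₂` WITNESS IN THE BINDERS OF THE Γ-FREE LADDER — `(𝔸³_K, (xy + z³)·𝒪, 2)` meets ALL
# eleven binders of `GammaFreeGlobalOrderReductionDimLE p 3` and the slice hypotheses, non-trivially; the ladder slice
# `gammaFreeGlobalDimLE_isolated_two_le_tau_slice` applies to it LITERALLY

Cell res-hironaka, LADDER-RESOLUTION rung L (D-0089), slot W4.6, rung (ii) (threefold hypersurfaces); seat res-L1-s46-pv-3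
(gen 4). Host route MarkedTransfer, host item `HypersurfaceOrderReductionDimLeThree` (stmt-ResolutionOfSingularities-16156);
filed `--kind proof --supports` it `--as helper`. Companion of `…ThreefoldsTauTwoWitness.lean` (p526209): the remaining
binders of the statement of record (`I ≠ ⊥`, effective Cartier, separated / finite type / quasi-compact / integral / regular /
`dim ≤ 3`) for the `A₂` input, the non-triviality `¬ ∀ x, ord_x < 2`, the packaged existence statement, and the ladder slice
(p516287) applied to the witness verbatim. OURS bookkeeping; nothing of H. Hironaka's manuscript is asserted. AI-written; AI
review is weaker than expert review.

## What is proved (no definitions)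

* `CampaignW46.A2Witness.a2Poly_ne_zero`, `…a2Sheaf_ne_bot`, `…isEffectiveCartier_a2Sheaf`, `…not_forall_idealOrder_lt_two`.
* `CampaignW46.A2Witness.exists_ladder_input_isolated_two_le_tau` — **for every prime `p` and every field `K` of characteristic
  `p` there is an input of the ladder `d = 3` (all eleven binders, `m = 2`) meeting the hypotheses of the isolated `τ ≥ 2` slice
  with ONE bad point, and NOT trivially order-reducible.**
* `CampaignW46.A2Witness.orderReducible_of_ladder_slice` — the ladder slice `gammaFreeGlobalDimLE_isolated_two_le_tau_slice p 3`
  applied to the witness, binders supplied literally (perfect `K`).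

References: `…ThreefoldsTauTwoWitness.lean` (p526209), `…ThreefoldsTauTwoSliceFiniteType.lean` (p516287),
`…GammaFreeGlobalLadderWitness.lean` (affine-space binders), tree `Resolution/BlowupChartMembership.lean`
(`isEffectiveCartier_of_ideal_top_eq_span`), `Hironaka2017/Lib/SpecOrders.lean`. [CossartPiltant2008] H. Hironaka, ms. 2017-03-23 —
scope only, under adjudication, not cited as fact. [Hironaka2017]
-/

noncomputable section

set_option linter.dupNamespace false -- mandated namespace of this single-conjunct summit

open CategoryTheory AlgebraicGeometry TopologicalSpace IsLocalRing MvPolynomial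

namespace Summit.ResolutionOfSingularities.ResolutionOfSingularities.Theorems

namespace CampaignW46

namespace A2Witness

open Literature.AlgebraicGeometry.Resolution
open Literature.AlgebraicGeometry.Hironaka2017.SpecOrders
open Scheme.IdealSheafData

universe u

variable (K : Type u) [Field K]

/-- `xy + z³ ≠ 0` (it takes the value `1` at `(1, 1, 0)`). [folklore] -/
theorem a2Poly_ne_zero : a2Poly K ≠ 0 := by
  intro h
  have h1 := congrArg (MvPolynomial.eval (fun i : Fin 3 => if i = 2 then (0 : K) else 1)) h
  simp only [map_add, map_mul, map_pow, eval_X, map_zero] at h1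
  simp at h1

/-- `R ≅ Γ(Spec R, ⊤)` is injective (plumbing). [folklore] -/
theorem toΓ_injective_A3 : Function.Injective (toΓ (A3 K)) := fun a b h => by
  have := congrArg (ofΓ (A3 K)) h
  rwa [ofΓ_toΓ, ofΓ_toΓ] at this

/-- **`(xy + z³)·𝒪 ≠ ⊥`.** [folklore] -/
theorem a2Sheaf_ne_bot : a2Sheaf K ≠ ⊥ := by
  intro h
  have h1 := shf_ideal_top (A3 K) (Ideal.span {a2Poly K})
  rw [show shf (A3 K) (Ideal.span {a2Poly K}) = a2Sheaf K from rfl, h, Scheme.IdealSheafData.ideal_bot, Pi.bot_apply,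
    eq_comm, Ideal.map_span, Set.image_singleton, Ideal.span_singleton_eq_bot] at h1
  exact a2Poly_ne_zero K (toΓ_injective_A3 K (h1.trans (map_zero _).symm))

/-- **`(xy + z³)·𝒪` is an effective Cartier ideal** (principal, generated by a nonzerodivisor of the domain `K[x,y,z]`).
[cite: GortzWedhorn2020, (13.19) p. 413 with Remark 11.27] -/
theorem isEffectiveCartier_a2Sheaf : IsEffectiveCartier (a2Sheaf K) := by
  have hg : a2Poly K ∈ nonZeroDivisors (A3 K) := mem_nonZeroDivisors_of_ne_zero (a2Poly_ne_zero K)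
  refine isEffectiveCartier_of_ideal_top_eq_span _ (g := toΓ (A3 K) (a2Poly K)) ?_ ?_
  · exact mem_nonZeroDivisors_of_inverse (toΓ (A3 K)) (ofΓ (A3 K)) (ofΓ_toΓ (A3 K)) (toΓ_ofΓ (A3 K)) hg
  · rw [show (a2Sheaf K) = shf (A3 K) (Ideal.span {a2Poly K}) from rfl, shf_ideal_top, Ideal.map_span,
      Set.image_singleton]

/-- **The input is not trivially order-reducible**: `ord = 2` at the origin, so `¬ ∀ x, ord_x < 2`. [folklore] -/
theorem not_forall_idealOrder_lt_two : ¬ ∀ x : Zs (A3 K), idealOrder (a2Sheaf K) x < ((2 : ℕ) : ℕ∞) := fun h =>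
  absurd (h (origin K)) (by rw [idealOrder_origin]; exact lt_irrefl _)

/-- The origin is a closed point of `𝔸³_K`. [folklore] -/
theorem isClosed_origin : IsClosed ({origin K} : Set (Zs (A3 K))) :=
  (PrimeSpectrum.isClosed_singleton_iff_isMaximal _).mpr (originIdeal.isMaximal K 3)

/-- **NON-VACUITY OF THE ISOLATED `τ ≥ 2` SLICE IN THE BINDERS OF THE LADDER `d = 3`**: for every prime `p` and every field
`K` of characteristic `p`, affine `3`-space with the ideal `(xy + z³)` and `m = 2` is a separated, locally-of-finite-type,
quasi-compact, integral, regular `K`-scheme of dimension `≤ 3` with a non-zero effective Cartier ideal whose order-`2` locus is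
ONE closed point of order `2`, embedding dimension `3` and `τ ≥ 2` — and `¬ ∀ x, ord_x < 2`. (For perfect `K` these are
literally the binders of `gammaFreeGlobalDimLE_isolated_two_le_tau_slice p 3`.) [folklore] -/
theorem exists_ladder_input_isolated_two_le_tau (p : ℕ) [Fact p.Prime] [CharP K p] :
    ∃ (X : Scheme.{u}) (s : X ⟶ Spec (.of K)), IsSeparated s ∧ LocallyOfFiniteType s ∧ QuasiCompact s ∧
      IsIntegral X ∧ ∃ hreg : Scheme.IsRegular X, topologicalKrullDim X ≤ ((3 : ℕ) : WithBot ℕ∞) ∧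
      ∃ (I : X.IdealSheafData), I ≠ ⊥ ∧ IsEffectiveCartier I ∧
        (¬ ∀ x : X, idealOrder I x < ((2 : ℕ) : ℕ∞)) ∧
        ∃ ξ : X, IsClosed ({ξ} : Set X) ∧ (∀ x : X, ((2 : ℕ) : ℕ∞) ≤ idealOrder I x → x ∈ ({ξ} : Set X)) ∧
          idealOrder I ξ = ((2 : ℕ) : ℕ∞) ∧ (maximalIdeal (X.presheaf.stalk ξ)).spanFinrank = 3 ∧
          (haveI := hreg ξ; 2 ≤ stalkTau I ξ 2) :=
  ⟨Zs (A3 K), Spec.map (CommRingCat.ofHom (algebraMap K (A3 K))), LadderWitness.isSeparated_affineSpace K 3,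
    LadderWitness.locallyOfFiniteType_affineSpace K 3, LadderWitness.quasiCompact_affineSpace K 3,
    LadderWitness.isIntegral_affineSpace K 3, LadderWitness.isRegular_affineSpace K 3,
    LadderWitness.topologicalKrullDim_affineSpace_le K 3 le_rfl, a2Sheaf K, a2Sheaf_ne_bot K,
    isEffectiveCartier_a2Sheaf K, not_forall_idealOrder_lt_two K, origin K, isClosed_origin K,
    fun _ hx => Set.mem_singleton_iff.mpr (eq_origin_of_two_le_idealOrder hx), idealOrder_origin,
    spanFinrank_origin K, two_le_stalkTau_origin K⟩

/-- **The ladder slice applied to the witness, binders supplied LITERALLY** (perfect `K` of characteristic `p`): the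
isolated `τ ≥ 2` slice of `GammaFreeGlobalOrderReductionDimLE p 3` (p516287) gives `OrderReducible ((xy + z³)·𝒪) 2`. [folklore] -/
theorem orderReducible_of_ladder_slice (p : ℕ) [Fact p.Prime] [CharP K p] [PerfectField K] :
    OrderReducible (a2Sheaf K) 2 :=
  gammaFreeGlobalDimLE_isolated_two_le_tau_slice.{u} p 3 Fact.out K (Zs (A3 K))
    (Spec.map (CommRingCat.ofHom (algebraMap K (A3 K)))) (LadderWitness.isSeparated_affineSpace K 3)
    (LadderWitness.locallyOfFiniteType_affineSpace K 3) (LadderWitness.quasiCompact_affineSpace K 3)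
    (LadderWitness.isIntegral_affineSpace K 3) (LadderWitness.isRegular_affineSpace K 3)
    (LadderWitness.topologicalKrullDim_affineSpace_le K 3 le_rfl) (a2Sheaf K) (a2Sheaf_ne_bot K)
    (isEffectiveCartier_a2Sheaf K) 2 (by norm_num) {origin K} (Set.finite_singleton _)
    (fun x hx => by rw [Set.mem_singleton_iff.mp hx]; exact isClosed_origin K)
    (fun x hx => Set.mem_singleton_iff.mpr (eq_origin_of_two_le_idealOrder hx))
    (fun x hx => by rw [Set.mem_singleton_iff.mp hx]; exact idealOrder_origin)
    (fun x hx => by rw [Set.mem_singleton_iff.mp hx]; exact spanFinrank_origin K)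
    (fun x hx => by obtain rfl := Set.mem_singleton_iff.mp hx; exact two_le_stalkTau_origin K)

end A2Witness

end CampaignW46

end Summit.ResolutionOfSingularities.ResolutionOfSingularities.Theorems

end
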